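import Literature.Analysis.FluidPDE.ElgindiOperatorLocality
import Literature.Analysis.FluidPDE.ElgindiCommutatorCalculus
import Literature.Analysis.FluidPDE.ElgindiSliceBounds
import Literature.Analysis.FluidPDE.ElgindiStripIterates
import Literature.Analysis.Distribution.ConvolutionPowerBumps
import Mathlib.Analysis.SpecialFunctions.Log.Deriv
import HarnessLib

/-!
# Logarithmic radial cut-offs and the commutator `[L, η]` of Elgindi's operator
([Elgindi2021] §7.3 Step 3; [ElgindiGhoulMasmoudi2021] Remark 9.8)

Topic `Literature/Analysis/FluidPDE`. Support file (definitions with bodies and proved theorems, no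
named facts) on the proof path of the named fact
`Literature.Analysis.FluidPDE.Elgindi.ElgindiGhoulMasmoudi2021_stabilityCore`
(`ElgindiStabilityDecomposition.lean`). T. M. Elgindi, Ann. of Math. 194 (2021) =
arXiv:1904.04795, §7.3 (p. 21); Elgindi–Ghoul–Masmoudi, arXiv:1910.14071, Remark 9.8 (p. 20: radial
cut-offs with `M`-uniform `D_z`-bounds).

* `logCut n G z = G(log z/n)`: `Dz₁(logCut n G) = n⁻¹ logCut n G′` on `z > 0`, hence all
  `Dz₁`-iterates of positive order are `O(1/n)` (`iterate_Dz₁_logCut`, `abs_iterate_Dz₁_logCut_le`).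
* the plateau profile `logPlateau` (`= 1` on `[−1,1]`, `= 0` off `(−2,2)`) and the cut-offs
  `etaCut n = logCut n logPlateau` (`= 1` on `[e^{−n}, eⁿ]`, supported in `[e^{−2n}, e^{2n}] ⊆ (0,∞)`).
* **the commutator formula** on the strip for `Ψ ∈ C^∞(strip)` and a radial `η ∈ C^∞(0,∞)`:
  `L(ηΨ) = ηLΨ − α²(z²η″)Ψ − 2α²(zη′)D_RΨ − α(5+α)(zη′)Ψ` (`ellipticOp_radialMul`).
-/

noncomputable section

open Set Real Filter Function
open _root_.Topology
open scoped ContDiff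

namespace Literature.Analysis.FluidPDE

namespace Elgindi

/-! ### Logarithmic dilations -/

/-- `logCut n G z = G(log z / n)`. [folklore] -/
def logCut (n : ℝ) (G : ℝ → ℝ) (z : ℝ) : ℝ := G (Real.log z / n)

/-- `Dz₁(G(log z/n)) = n⁻¹G′(log z/n)` for `z > 0`. [folklore] -/
theorem Dz₁_logCut {n : ℝ} (hn : n ≠ 0) {G : ℝ → ℝ} (hG : Differentiable ℝ G) {z : ℝ} (hz : 0 < z) :
    Dz₁ (logCut n G) z = n⁻¹ * logCut n (deriv G) z := by
  unfold Dz₁ logCut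
  have h1 : HasDerivAt (fun z => Real.log z / n) (z⁻¹ / n) z := (Real.hasDerivAt_log hz.ne').div_const n
  have h2 := (hG (Real.log z / n)).hasDerivAt.comp z h1
  rw [show (fun z => G (Real.log z / n)) = G ∘ fun z => Real.log z / n from rfl, h2.deriv]
  field_simp

/-- Locality of `Dz₁`-iterates on `(0,∞)`. [folklore] -/
theorem iterate_Dz₁_congr_Ioi {c c' : ℝ → ℝ} (h : EqOn c c' (Ioi 0)) (l : ℕ) : EqOn (Dz₁^[l] c) (Dz₁^[l] c') (Ioi 0) := by
  induction l generalizing c c' with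
  | zero => exact h
  | succ l ih =>
    intro z hz
    rw [Function.iterate_succ_apply, Function.iterate_succ_apply]
    refine ih (fun w hw => ?_) hz
    show w * deriv c w = w * deriv c' w
    rw [Filter.EventuallyEq.deriv_eq (h.eventuallyEq_of_mem (isOpen_Ioi.mem_nhds hw))]

/-- `Dz₁^l (a • c) = a • Dz₁^l c`. [folklore] -/
theorem iterate_Dz₁_const_mul' (a : ℝ) (c : ℝ → ℝ) (l : ℕ) : Dz₁^[l] (fun z => a * c z) = fun z => a * (Dz₁^[l] c) z := by
  induction l generalizing c with
  | zero => rfl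
  | succ l ih =>
    have : Dz₁ (fun z => a * c z) = fun z => a * Dz₁ c z := by
      funext z; show z * deriv (fun z => a * c z) z = a * (z * deriv c z); rw [deriv_const_mul_field]; ring
    rw [Function.iterate_succ_apply, this, ih (Dz₁ c), ← Function.iterate_succ_apply]

/-- **`Dz₁^l(G(log z/n)) = n^{−l}G^{(l)}(log z/n)` on `z > 0`.** [cite: ElgindiGhoulMasmoudi2021, Remark 9.8 (p. 20 of arXiv:1910.14071)] -/
theorem iterate_Dz₁_logCut {n : ℝ} (hn : n ≠ 0) {G : ℝ → ℝ} (hG : ContDiff ℝ ∞ G) (l : ℕ) :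
    EqOn (Dz₁^[l] (logCut n G)) (fun z => (n⁻¹) ^ l * logCut n (iteratedDeriv l G) z) (Ioi 0) := by
  induction l generalizing G with
  | zero => intro z _; simp
  | succ l ih =>
    intro z hz
    rw [Function.iterate_succ_apply]
    have hG1 : Differentiable ℝ G := hG.differentiable (by simp)
    have e1 : EqOn (Dz₁ (logCut n G)) (fun w => n⁻¹ * logCut n (deriv G) w) (Ioi 0) := fun w hw => Dz₁_logCut hn hG1 hw
    rw [iterate_Dz₁_congr_Ioi e1 l hz]
    -- `Dz₁^l (n⁻¹ • logCut n G') = n⁻¹ Dz₁^l (logCut n G')`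
    have e2 : (fun w => n⁻¹ * logCut n (deriv G) w) = fun w => n⁻¹ * (logCut n (deriv G)) w := rfl
    rw [e2, iterate_Dz₁_const_mul']
    show n⁻¹ * (Dz₁^[l] (logCut n (deriv G))) z = (n⁻¹) ^ (l + 1) * logCut n (iteratedDeriv (l + 1) G) z
    rw [ih (hG.deriv') hz, iteratedDeriv_succ']
    ring

/-- A continuous compactly supported function is bounded. [folklore] -/
theorem exists_bound_of_hasCompactSupport {G : ℝ → ℝ} (hG : Continuous G) (hs : HasCompactSupport G) : ∃ B, 0 ≤ B ∧ ∀ x, |G x| ≤ B := by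
  obtain ⟨B, hB⟩ := hs.exists_bound_of_continuous hG
  exact ⟨max B 0, le_max_right _ _, fun x => by have := hB x; rw [Real.norm_eq_abs] at this; exact this.trans (le_max_left _ _)⟩

/-- **`|Dz₁^l(G(log z/n))| ≤ B_l/n` on `z > 0` for `l ≥ 1`, `n ≥ 1`**, `G ∈ C_c^∞`. [cite: ElgindiGhoulMasmoudi2021, Remark 9.8 (p. 20 of arXiv:1910.14071)] -/
theorem abs_iterate_Dz₁_logCut_le {G : ℝ → ℝ} (hG : ContDiff ℝ ∞ G) (hs : HasCompactSupport G) (l : ℕ) :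
    ∃ B, 0 ≤ B ∧ ∀ n : ℝ, 1 ≤ n → ∀ z ∈ Ioi (0:ℝ), |(Dz₁^[l + 1] (logCut n G)) z| ≤ B / n := by
  obtain ⟨B, hB0, hB⟩ := exists_bound_of_hasCompactSupport (hG.continuous_iteratedDeriv (l + 1) (by exact_mod_cast le_top)) (Literature.Analysis.Distribution.hasCompactSupport_iteratedDeriv hs (l + 1))
  refine ⟨B, hB0, fun n hn z hz => ?_⟩
  have hn0 : n ≠ 0 := by positivity
  rw [iterate_Dz₁_logCut hn0 hG (l + 1) hz, abs_mul]
  have h1 : |(n⁻¹) ^ (l + 1)| ≤ 1 / n := by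
    rw [abs_of_nonneg (by positivity), pow_succ, one_div]
    have hle : (n⁻¹) ^ l ≤ 1 := pow_le_one₀ (by positivity) (inv_le_one_of_one_le₀ hn)
    have : (n⁻¹) ^ l * n⁻¹ ≤ 1 * n⁻¹ := mul_le_mul_of_nonneg_right hle (by positivity)
    simpa using this
  calc |(n⁻¹) ^ (l + 1)| * |logCut n (iteratedDeriv (l + 1) G) z| ≤ (1 / n) * B := mul_le_mul h1 (hB _) (abs_nonneg _) (by positivity)
    _ = B / n := by ring

/-- `|G(log z/n)| ≤ sup|G|`. [folklore] -/
theorem abs_logCut_le {G : ℝ → ℝ} (hG : Continuous G) (hs : HasCompactSupport G) :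
    ∃ B, 0 ≤ B ∧ ∀ n z, |logCut n G z| ≤ B := by
  obtain ⟨B, hB0, hB⟩ := exists_bound_of_hasCompactSupport hG hs
  exact ⟨B, hB0, fun n z => hB (Real.log z / n)⟩

/-- `logCut n G` is smooth on `(0,∞)`. [folklore] -/
theorem contDiffOn_logCut (n : ℝ) {G : ℝ → ℝ} (hG : ContDiff ℝ ∞ G) : ContDiffOn ℝ ∞ (logCut n G) (Ioi 0) :=
  hG.comp_contDiffOn ((Real.contDiffOn_log.mono fun z (hz : z ∈ Ioi (0:ℝ)) => ne_of_gt hz).div_const n)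

/-! ### The plateau profile and the cut-offs `η_n` -/

/-- The plateau bump: Mathlib's `ContDiffBump` at `0` with radii `1 < 2`. [folklore] -/
def logPlateauBump : ContDiffBump (0:ℝ) := ⟨1, 2, one_pos, one_lt_two⟩

/-- The logPlateau `= 1` on `[−1,1]`, `= 0` off `(−2,2)`, smooth, values in `[0,1]`. [folklore] -/
def logPlateau : ℝ → ℝ := logPlateauBump

/-- Smoothness of the logPlateau. [folklore] -/
theorem contDiff_logPlateau : ContDiff ℝ ∞ logPlateau := logPlateauBump.contDiff

/-- `logPlateau = 1` on `[−1, 1]`. [folklore] -/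
theorem logPlateau_eq_one {s : ℝ} (hs : |s| ≤ 1) : logPlateau s = 1 :=
  logPlateauBump.one_of_mem_closedBall (by rw [Metric.mem_closedBall, Real.dist_eq, sub_zero]; exact hs)

/-- `logPlateau = 0` off `(−2, 2)`. [folklore] -/
theorem logPlateau_eq_zero {s : ℝ} (hs : 2 ≤ |s|) : logPlateau s = 0 :=
  logPlateauBump.zero_of_le_dist (by rw [Real.dist_eq, sub_zero]; exact hs)

/-- `|logPlateau| ≤ 1`. [folklore] -/
theorem abs_logPlateau_le (s : ℝ) : |logPlateau s| ≤ 1 := by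
  show |(logPlateauBump : ℝ → ℝ) s| ≤ 1
  rw [abs_of_nonneg logPlateauBump.nonneg]; exact logPlateauBump.le_one

/-- The logPlateau has compact support. [folklore] -/
theorem hasCompactSupport_logPlateau : HasCompactSupport logPlateau := logPlateauBump.hasCompactSupport

/-- **The logarithmic cut-offs** `η_n(z) = logPlateau(log z/n)`. [folklore] -/
def etaCut (n : ℝ) : ℝ → ℝ := logCut n logPlateau

/-- `η_n = 1` on `[e^{−n}, eⁿ]`. [folklore] -/
theorem etaCut_eq_one {n : ℝ} (hn : 0 < n) {z : ℝ} (h1 : |Real.log z| ≤ n) : etaCut n z = 1 := by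
  unfold etaCut logCut
  apply logPlateau_eq_one
  rw [abs_div, abs_of_pos hn, div_le_one hn]; exact h1

/-- `η_n = 0` for `|log z| ≥ 2n` (`z > 0`). [folklore] -/
theorem etaCut_eq_zero {n : ℝ} (hn : 0 < n) {z : ℝ} (h2 : 2 * n ≤ |Real.log z|) : etaCut n z = 0 := by
  unfold etaCut logCut
  apply logPlateau_eq_zero
  rw [abs_div, abs_of_pos hn, le_div_iff₀ hn]; linarith

/-- `|η_n| ≤ 1`. [folklore] -/
theorem abs_etaCut_le (n z : ℝ) : |etaCut n z| ≤ 1 := abs_logPlateau_le _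

/-- `η_n` is smooth on `(0,∞)`. [folklore] -/
theorem contDiffOn_etaCut (n : ℝ) : ContDiffOn ℝ ∞ (etaCut n) (Ioi 0) := contDiffOn_logCut n contDiff_logPlateau

/-- `η_n → 1` pointwise on `z > 0` (indeed eventually `= 1`). [folklore] -/
theorem tendsto_etaCut (z : ℝ) : Tendsto (fun n : ℕ => etaCut (n + 1 : ℝ) z) atTop (𝓝 1) := by
  refine tendsto_const_nhds.congr' ?_
  obtain ⟨N, hN⟩ := exists_nat_ge |Real.log z|
  filter_upwards [Filter.eventually_ge_atTop N] with n hn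
  exact (etaCut_eq_one (by positivity) (hN.trans (by exact_mod_cast Nat.le_succ_of_le hn))).symm

/-- Positive-order `Dz₁`-iterates of `η_n` tend to `0` pointwise on `z > 0`. [folklore] -/
theorem tendsto_iterate_Dz₁_etaCut (l : ℕ) {z : ℝ} (hz : 0 < z) : Tendsto (fun n : ℕ => (Dz₁^[l + 1] (etaCut (n + 1 : ℝ))) z) atTop (𝓝 0) := by
  obtain ⟨B, -, hB⟩ := abs_iterate_Dz₁_logCut_le contDiff_logPlateau hasCompactSupport_logPlateau l
  have hbd : ∀ n : ℕ, |(Dz₁^[l + 1] (etaCut (n + 1 : ℝ))) z| ≤ B / ((n : ℝ) + 1) := fun n =>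
    hB _ (by simp) z hz
  have h0 : Tendsto (fun n : ℕ => B / ((n : ℝ) + 1)) atTop (𝓝 0) := by
    have := tendsto_one_div_add_atTop_nhds_zero_nat.const_mul B
    rw [mul_zero] at this
    exact this.congr fun n => by ring
  exact squeeze_zero_norm (fun n => by rw [Real.norm_eq_abs]; exact hbd n) h0

/-- The cut-off restricted to `z > 0` and extended by `0` (`log` has junk values on `z ≤ 0`; this
version is globally smooth and compactly supported in `(0,∞)`). [folklore] -/
def etaCutPos (n : ℝ) (z : ℝ) : ℝ := if 0 < z then etaCut n z else 0

/-- `etaCutPos = etaCut` on `(0,∞)`. [folklore] -/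
theorem etaCutPos_of_pos {n z : ℝ} (hz : 0 < z) : etaCutPos n z = etaCut n z := if_pos hz

/-- `etaCutPos n = 0` on `z < e^{−2n}` (`n > 0`), in particular near `z ≤ 0`. [folklore] -/
theorem etaCutPos_eq_zero_of_lt {n : ℝ} (hn : 0 < n) {z : ℝ} (hz : z < Real.exp (-(2 * n))) : etaCutPos n z = 0 := by
  unfold etaCutPos
  split_ifs with h
  · apply etaCut_eq_zero hn
    have hlog : Real.log z < -(2 * n) := by
      have := Real.log_lt_log h hz; rwa [Real.log_exp] at this
    rw [abs_of_neg (by linarith)]; linarith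
  · rfl

/-- `etaCutPos n = 0` for `z > e^{2n}`. [folklore] -/
theorem etaCutPos_eq_zero_of_gt {n : ℝ} (hn : 0 < n) {z : ℝ} (hz : Real.exp (2 * n) < z) : etaCutPos n z = 0 := by
  have hzpos : 0 < z := (Real.exp_pos _).trans hz
  rw [etaCutPos_of_pos hzpos]
  apply etaCut_eq_zero hn
  have hlog : 2 * n < Real.log z := by
    have := Real.log_lt_log (Real.exp_pos _) hz; rwa [Real.log_exp] at this
  rw [abs_of_pos (by linarith)]; linarith

/-- **`etaCutPos n ∈ C^∞(ℝ)`** (it vanishes near `z ≤ 0`). [folklore] -/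
theorem contDiff_etaCutPos {n : ℝ} (hn : 0 < n) : ContDiff ℝ ∞ (etaCutPos n) := by
  refine contDiff_iff_contDiffAt.2 fun z => ?_
  rcases lt_or_ge z (Real.exp (-(2 * n))) with hz | hz
  · -- locally zero
    have hev : etaCutPos n =ᶠ[𝓝 z] fun _ => 0 := by
      filter_upwards [Iio_mem_nhds hz] with w hw
      exact etaCutPos_eq_zero_of_lt hn hw
    exact (contDiffAt_const (c := (0:ℝ))).congr_of_eventuallyEq hev
  · have hzpos : 0 < z := (Real.exp_pos _).trans_le hz
    have hev : etaCutPos n =ᶠ[𝓝 z] etaCut n := by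
      filter_upwards [Ioi_mem_nhds hzpos] with w hw
      exact etaCutPos_of_pos hw
    exact ((contDiffOn_etaCut n).contDiffAt (Ioi_mem_nhds hzpos)).congr_of_eventuallyEq hev

/-- `etaCutPos n` has compact support in `[e^{−2n}, e^{2n}] ⊆ (0,∞)`. [folklore] -/
theorem hasCompactSupport_etaCutPos {n : ℝ} (hn : 0 < n) : HasCompactSupport (etaCutPos n) := by
  refine HasCompactSupport.of_support_subset_isCompact (isCompact_Icc (a := Real.exp (-(2 * n))) (b := Real.exp (2 * n))) fun z hz => ?_
  by_contra hc
  simp only [mem_Icc, not_and_or, not_le] at hc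
  apply hz
  rcases hc with h | h
  · exact etaCutPos_eq_zero_of_lt hn h
  · exact etaCutPos_eq_zero_of_gt hn h

/-- `tsupport (etaCutPos n) ⊆ (0,∞)`. [folklore] -/
theorem tsupport_etaCutPos {n : ℝ} (hn : 0 < n) : tsupport (etaCutPos n) ⊆ Ioi 0 := by
  intro z hz
  by_contra hneg
  simp only [mem_Ioi, not_lt] at hneg
  have hlt : z < Real.exp (-(2 * n)) := hneg.trans_lt (Real.exp_pos _)
  have hev : etaCutPos n =ᶠ[𝓝 z] 0 := by
    filter_upwards [Iio_mem_nhds hlt] with w hw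
    exact etaCutPos_eq_zero_of_lt hn hw
  exact (notMem_tsupport_iff_eventuallyEq.2 hev) hz

/-! ### The commutator of `L` with a radial multiplier -/

/-- `∂_θ` commutes with radial multipliers (no hypotheses). [folklore] -/
theorem dθ_radialMul (c : ℝ → ℝ) (f : ℝ → ℝ → ℝ) (z θ : ℝ) : dθ (radialMul c f) z θ = c z * dθ f z θ := by
  show deriv (fun θ' => c z * f z θ') θ = c z * deriv (fun θ' => f z θ') θ
  exact deriv_const_mul_field _

/-- `∂_z(cf) = c′f + c∂_zf` on the strip for `c` differentiable on `(0,∞)` and `f ∈ C¹(strip)`. [folklore] -/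
theorem dz_radialMul_strip {c : ℝ → ℝ} (hc : DifferentiableOn ℝ c (Ioi 0)) {f : ℝ → ℝ → ℝ} (hf : ContDiffOn ℝ 1 (uncurry f) strip)
    {p : ℝ × ℝ} (hp : p ∈ strip) : dz (radialMul c f) p.1 p.2 = deriv c p.1 * f p.1 p.2 + c p.1 * dz f p.1 p.2 := by
  have h1 : HasDerivAt c (deriv c p.1) p.1 := (hc.differentiableAt (Ioi_mem_nhds hp.1)).hasDerivAt
  have h2 : HasDerivAt (fun z => f z p.2) (dz f p.1 p.2) p.1 := hasDerivAt_radial_slice hf hp.2 hp.1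
  have h12 : HasDerivAt (fun z => c z * f z p.2) _ p.1 := h1.mul h2
  show deriv (fun z => c z * f z p.2) p.1 = _
  rw [h12.deriv]

/-- **The commutator formula**: for `c ∈ C^∞(0,∞)` and `Ψ ∈ C^∞(strip)`,
`L(cΨ) = cLΨ − α²(z²c″)Ψ − 2α²(zc′)(z∂_zΨ) − α(5+α)(zc′)Ψ` on the strip.
[cite: Elgindi2021, §7.3 proof of Proposition 7.7, Step 3 (p. 21 of arXiv:1904.04795)] -/
theorem ellipticOp_radialMul (α : ℝ) {c : ℝ → ℝ} (hc : ContDiffOn ℝ ∞ c (Ioi 0)) {Ψ : ℝ → ℝ → ℝ} (hΨ : ContDiffOn ℝ ∞ (uncurry Ψ) strip)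
    {p : ℝ × ℝ} (hp : p ∈ strip) :
    ellipticOp α (radialMul c Ψ) p.1 p.2 =
      c p.1 * ellipticOp α Ψ p.1 p.2 - α ^ 2 * (p.1 ^ 2 * deriv (deriv c) p.1) * Ψ p.1 p.2 -
        2 * α ^ 2 * (p.1 * deriv c p.1) * (p.1 * dz Ψ p.1 p.2) - α * (5 + α) * (p.1 * deriv c p.1) * Ψ p.1 p.2 := by
  have hc1 : DifferentiableOn ℝ c (Ioi 0) := hc.differentiableOn (by simp)
  have hc' : ContDiffOn ℝ ∞ (deriv c) (Ioi 0) := hc.deriv_of_isOpen isOpen_Ioi (by simp)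
  have hc'1 : DifferentiableOn ℝ (deriv c) (Ioi 0) := hc'.differentiableOn (by simp)
  have hΨ1 : ContDiffOn ℝ 1 (uncurry Ψ) strip := hΨ.of_le (by exact_mod_cast le_top)
  have hdzΨ : ContDiffOn ℝ ∞ (uncurry (dz Ψ)) strip := contDiffOn_dz_strip hΨ
  -- first `z`-derivative on the whole strip, then differentiate again at `p`
  have e1 : ∀ q ∈ strip, dz (radialMul c Ψ) q.1 q.2 = (fun z θ => deriv c z * Ψ z θ + c z * dz Ψ z θ) q.1 q.2 := fun q hq =>
    dz_radialMul_strip hc1 hΨ1 hq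
  have e2 : dz (dz (radialMul c Ψ)) p.1 p.2 = dz (fun z θ => deriv c z * Ψ z θ + c z * dz Ψ z θ) p.1 p.2 := eqOn_dz isOpen_strip e1 hp
  have e3 : dz (fun z θ => deriv c z * Ψ z θ + c z * dz Ψ z θ) p.1 p.2 =
      (deriv (deriv c) p.1 * Ψ p.1 p.2 + deriv c p.1 * dz Ψ p.1 p.2) + (deriv c p.1 * dz Ψ p.1 p.2 + c p.1 * dz (dz Ψ) p.1 p.2) := by
    have hA : HasDerivAt (deriv c) (deriv (deriv c) p.1) p.1 := (hc'1.differentiableAt (Ioi_mem_nhds hp.1)).hasDerivAt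
    have hB : HasDerivAt c (deriv c p.1) p.1 := (hc1.differentiableAt (Ioi_mem_nhds hp.1)).hasDerivAt
    have hΨs : HasDerivAt (fun z => Ψ z p.2) (dz Ψ p.1 p.2) p.1 := hasDerivAt_radial_slice hΨ1 hp.2 hp.1
    have hdzs : HasDerivAt (fun z => dz Ψ z p.2) (dz (dz Ψ) p.1 p.2) p.1 := hasDerivAt_radial_slice (hdzΨ.of_le (by exact_mod_cast le_top)) hp.2 hp.1
    have hsum : HasDerivAt (fun z => deriv c z * Ψ z p.2 + c z * dz Ψ z p.2) _ p.1 := (hA.mul hΨs).add (hB.mul hdzs)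
    show deriv (fun z => deriv c z * Ψ z p.2 + c z * dz Ψ z p.2) p.1 = _
    rw [hsum.deriv]
  -- the angular terms commute with `c`
  have e4 : dθ (dθ (radialMul c Ψ)) p.1 p.2 = c p.1 * dθ (dθ Ψ) p.1 p.2 := by
    have : dθ (radialMul c Ψ) = radialMul c (dθ Ψ) := by funext z θ; exact dθ_radialMul c Ψ z θ
    rw [this, dθ_radialMul]
  have e5 : dθ (fun z' θ' => Real.tan θ' * radialMul c Ψ z' θ') p.1 p.2 = c p.1 * dθ (fun z' θ' => Real.tan θ' * Ψ z' θ') p.1 p.2 := by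
    have : (fun z' θ' => Real.tan θ' * radialMul c Ψ z' θ') = radialMul c fun z' θ' => Real.tan θ' * Ψ z' θ' := by
      funext z θ; simp only [radialMul_apply]; ring
    rw [this, dθ_radialMul]
  have e0 : dz (radialMul c Ψ) p.1 p.2 = deriv c p.1 * Ψ p.1 p.2 + c p.1 * dz Ψ p.1 p.2 := e1 p hp
  unfold ellipticOp
  rw [e2, e3, e4, e5, e0]
  simp only [radialMul_apply]
  ring

end Elgindi

end Literature.Analysis.FluidPDE
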